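import Summits.QuantumFields.BalabanUV.Beta.FP.TorusCompositeCovarianceTwoPolarSym
import Summits.QuantumFields.BalabanUV.Beta.FP.TorusCompositeCovarianceTwoStepSym
import Summits.QuantumFields.BalabanUV.Beta.FP.TorusCompositeCovarianceTwo

/-!
# `BalabanUV.Beta.FP.TorusCompositeCovarianceTwoSym` — road «FP» for binder row D1, ROUTE T, (β1) RE-BASING (ROW RULING R-D1-g52-1 (3)(c)), **(COV-m) ORDER 2 FOR
# THE (0.4)-SYMMETRISED TOWER AT EVERY DEPTH, `d + 1 = 4` — THE SYM COMPOSITE SECOND-ORDER INSERTION JET's GAUGE-COVARIANCE LAW ON ALL COLUMNS**: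
# `compIns₂Sym … n h · D_finest = 2 • (compIns₁Sym … n h · Tip(h)) − compRowsSym … n · Tip(h⊙h) + σ_n⁻¹ • Far_n((compRowsSym … n · h)⊙(compRowsSym … n · h))` —
# the sym twin of leaf-02 g26's I-4 `TorusCompositeCovarianceTwo.compIns₂_mul_tgrad` (the `c2 ∕ d2` rows of the `-Sym` door's record instance follow BY TERM, as
# `TorusCompositeCovarianceTwoRows` did for the rooted U21)

WHY.  R-23 DEFINES the sym composite second jet `compIns₂Sym` (the diagonal of the polarised ♭ chain rule `compIns₂₂Sym` over leaf-06's `compRowsSym`, R-18's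
`stepIns₁Sym`, R-19's `stepIns₂₂Sym`, R-21's `compIns₁Sym`) and proves its ♭ recursion `compIns₂Sym_succ` in I-4's shape; R-25 proves the one-step order-2 law
`stepIns₂Sym_mul_tgrad` at the record's dimension (`d + 1 = 4`, where the order-2 contact supplier lives).  This file is I-4's induction VERBATIM under the (β1)
substitution (`compIns₂ ↦ compIns₂Sym`, `compIns₁ ↦ compIns₁Sym`, `compRows ↦ compRowsSym`, `stepIns₂ M Lc (rs 1) ↦ stepIns₂Sym M Lc`, `stepIns₁ M Lc (rs 1) ↦
stepIns₁Sym M Lc`, `Qstep Lc M (lev 1) (rs 1) ↦ QstepSym Lc M (lev 1)`, `itRoot … rs hrs ↦ itRoot … (fun _ => ctrOff 4 Lc) (fun _ => hc)`, `hrs ↦ hc`): the one-step law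
(R-25), the COMPOSITE sym MASTER identity on all columns (R-21 `compRowsSym_mul_tgrad`) and the order-1 law (R-21 `compIns₁Sym_mul_tgrad`) feed the step exactly
as I-3 ∕ C1 ∕ C2 feed I-4's; the depth-`n+1` case opens with `rw [compIns₂Sym_succ]` (R-23 defines `compIns₂Sym` as the diagonal, whose unfolding is the polarised
form; the ♭ form with the `2 •` cross term is a theorem, not `rfl`).

WHAT (`d := 3`; blocking `Lc`, `[NeZero Lc]`; `hc : ctrOff (3+1) Lc ∈ box (3+1) Lc` displayed; the comb-root list `rs` a free parameter the sym objects ignore).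
* `compIns₂Sym_mul_tgrad_step` (push-inside types) and **`compIns₂Sym_mul_tgrad (hc) : ∀ n M lev rs h, compIns₂Sym Lc M lev rs n h * (tgrad (towerTorus Lc M n))↾(·, inl ·)
  id = 2 • (compIns₁Sym Lc M lev rs n h * Tip(h)) − compRowsSym Lc M lev rs n * Tip(h⊙h) + σ_n⁻¹ • Far_n((compRowsSym … *ᵥ h)⊙(compRowsSym … *ᵥ h))`**, `Tip(v)(b, s) =
  v b · [s ≡ b.1 + e_{b.2}]`, `Far_n(v)(a, s) = v a · [s = itRoot^{ρ_c} n (a.1 + e_{a.2})]`, `σ_n = ∏_{i<n} stepScale 3 Lc (lev (i+1)) · #B`.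
NOT HERE: the rows `c2 ∕ d2` by term (the sym twin of `TorusCompositeCovarianceTwoRows`); generic `d`; any chart; any estimate.  [folklore] finite sums BY NAME over
OUR bookkeeping objects; no `def`, no `def … : Prop`, nothing cited, 0 sorry, default heartbeats.  Nothing of the dictionary ∕ Bałaban's non-linear averages asserted
(that the re-based composite's second variation IS this ♭ chain rule is the ROW's (β1) ruling and an2's (C1) TABLE word, quoted); NO chart fixed; the (C1) TABLES,
the seven letters, `hH ∕ hQ` untouched.

HONEST DEPENDENCY (page 1, mandatory): continuum YM on T⁴ ⇐ BetaPertH ∧ nine spine estimates (0/9 proved); BetaPertH ⇐ (D1) ∧ (D4) ∧ CAP+tail;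
G-an2-4 gates asym, D1 and NE2/3/4.  HONEST FRAMING (cell contract, verbatim): «discharging `BetaPertH` makes Bałaban's UV stability UNCONDITIONAL —
a real constructive-QFT result; it is NOT the continuum limit and NOT the Clay problem.»  ABSOLUTE RULE (cell charter, verbatim): «No internally-minted
statement may enter as a cited fact. Every hypothesis is either kernel-proved in this package or a verbatim quotation of a PUBLISHED theorem with page
reference. The manuscript(s) under audit are NOT citable for their own disputed steps — they are the thing under adjudication; programme-internal
(2001/route/tribunal) claims are never citable.»  0 estimates; 0∕4 row-D1 binders (hW, hR, D1Tel, D1Rep); NOT (T-ID), NOT (C1), NOT SDF, NOT D1,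
NOT BetaPertH, NOT continuum, NOT Clay.  D1 formalisation swarm LEAF PROVER 02 (b2b-balaban-beta-d1-formalise-leaf-02 gen 32), 2026-08-24.  No existing file touched.
-/

noncomputable section

open scoped BigOperators

namespace Summit.QuantumFields.BalabanUV.Beta.FP.TorusCompositeCovarianceTwoSym

open Matrix Finset
open Literature.MathematicalPhysics.QuantumFieldTheory
open Literature.MathematicalPhysics.QuantumFieldTheory.Balaban1983to89
open Literature.MathematicalPhysics.QuantumFieldTheory.Balaban1983to89.Beta
open B5Prop11Plancherel (fine)
open B6Lemma24Torus (pbox mem_pbox)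
open AffineAveraging (Site box toSite unitVec)
open AveragingContoursRooted (ctr ctrOff ctrOff_mem_box)
open OneStepResolventKernel (Fib)
open Summit.QuantumFields.BalabanUV.Beta.BorderedHessian (stepScale stepScale_ne_zero)
open Summit.QuantumFields.BalabanUV.Beta.FP.KernelPeriodisationFib (Idx)
open Summit.QuantumFields.BalabanUV.Beta.FP.TorusGaugeCovariance (tdelta tgrad)
open Summit.QuantumFields.BalabanUV.Beta.FP.TorusGaugeCovariancePairing (wrapPt wrapPt_of_mem)
open Summit.QuantumFields.BalabanUV.Beta.FP.TorusCompositeObjects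
open Summit.QuantumFields.BalabanUV.Beta.FP.TorusCompositeObjectsG (QstepSym QSym compRowsSym)
open Summit.QuantumFields.BalabanUV.Beta.FP.TorusCompositeCovariance (rootPt itRoot itRoot_zero itRoot_succ)
open Summit.QuantumFields.BalabanUV.Beta.FP.TorusCompositeCovarianceOne (tdelta_wrapPt of_tdelta_mul prod_stepScale_mul_card_ne_zero')
open Summit.QuantumFields.BalabanUV.Beta.FP.TorusCompositeCovarianceTwo (card_box_cast)
open Summit.QuantumFields.BalabanUV.Beta.FP.TorusStepInsertionSym (stepIns₁Sym)
open Summit.QuantumFields.BalabanUV.Beta.FP.TorusStepInsertionSymTwo (stepIns₂₂Sym stepIns₂Sym)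
open Summit.QuantumFields.BalabanUV.Beta.FP.TorusCompositeCovarianceOneSym (compIns₁Sym compRowsSym_mul_tgrad compIns₁Sym_mul_tgrad)
open Summit.QuantumFields.BalabanUV.Beta.FP.TorusCompositeCovarianceTwoPolarSym (compIns₂₂Sym compIns₂Sym compIns₂Sym_succ compIns₂Sym_zero)
open Summit.QuantumFields.BalabanUV.Beta.FP.TorusCompositeCovarianceTwoStepSym (stepIns₂Sym_mul_tgrad)

section Tower

variable (Lc : ℕ) [NeZero Lc]

/-- [folklore] **(COV-m) ORDER 2, THE INDUCTION STEP** (top peel; stated in the tower's push-inside types — `compIns₂ … (n+1)`, `compIns₁ … (n+1)`, `compRows … (n+1)`,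
`itRoot … (n+1)` UNFOLDED by `rfl`): the three summands against the finest gradient — the top step's second jet meets the COMPOSITE MASTER identity and then PART 1's
ONE-STEP law (its two tips give `2θ•stepIns₁(C h)·Far_n(C h)`, cancelled by the cross term's far part; its diagonal `−σ⁻¹•Qstep·Far_n((C h)²)` CANCELS the lower law's
far-root term carried by the top rows — this is what fixes the weight `θ_n∕σ_n`; its far root is the new one, weight `σ_{n+1}⁻¹` by `#B = Lc^{d+1}`); the cross term reads
C1's lower law; the top rows carry the lower law's tip terms to the composite tip terms. -/
theorem compIns₂Sym_mul_tgrad_step (n : ℕ) (M : Fin (3 + 1) → ℕ) [∀ μ, NeZero (M μ)] (lev : ℕ → ℕ) (rs : ℕ → (Fin (3 + 1) → ℕ))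
    (hc : ctrOff (3 + 1) Lc ∈ box (3 + 1) Lc) (h : ↥(pbox (towerTorus Lc (fine Lc M) n)) × Fin (3 + 1) → ℝ)
    (ih : compIns₂Sym Lc (fine Lc M) (fun k => lev (k + 1)) (fun k => rs (k + 1)) n h
        * (tgrad (towerTorus Lc (fine Lc M) n)).submatrix
            (fun b : ↥(pbox (towerTorus Lc (fine Lc M) n)) × Fin (3 + 1) => ((b.1, Sum.inl b.2) : Idx (towerTorus Lc (fine Lc M) n) (Fib 3))) id
      = (2 : ℝ) • (compIns₁Sym Lc (fine Lc M) (fun k => lev (k + 1)) (fun k => rs (k + 1)) n h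
            * Matrix.of (fun (b : ↥(pbox (towerTorus Lc (fine Lc M) n)) × Fin (3 + 1)) (s : ↥(pbox (towerTorus Lc (fine Lc M) n))) =>
                h b * tdelta (towerTorus Lc (fine Lc M) n) ((b.1 : Site (3 + 1)) + unitVec b.2) s))
        - compRowsSym Lc (fine Lc M) (fun k => lev (k + 1)) (fun k => rs (k + 1)) n
            * Matrix.of (fun (b : ↥(pbox (towerTorus Lc (fine Lc M) n)) × Fin (3 + 1)) (s : ↥(pbox (towerTorus Lc (fine Lc M) n))) =>
                (h b * h b) * tdelta (towerTorus Lc (fine Lc M) n) ((b.1 : Site (3 + 1)) + unitVec b.2) s)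
        + (∏ i ∈ range n, (stepScale 3 Lc (lev (i + 1 + 1)) * ((box (3 + 1) Lc).card : ℝ)))⁻¹ •
            Matrix.of (fun (a : ↥(pbox (fine Lc M)) × Fin (3 + 1)) (s : ↥(pbox (towerTorus Lc (fine Lc M) n))) =>
              ((compRowsSym Lc (fine Lc M) (fun k => lev (k + 1)) (fun k => rs (k + 1)) n *ᵥ h) a) ^ 2
                * tdelta (towerTorus Lc (fine Lc M) n)
                    ((itRoot Lc (fine Lc M) (fun _ => ctrOff (3 + 1) Lc) (fun _ => hc) n
                        (wrapPt (fine Lc M) ((a.1 : Site (3 + 1)) + unitVec a.2)) : ↥(pbox (towerTorus Lc (fine Lc M) n))) : Site (3 + 1)) s)) :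
    (((((Lc : ℝ) ^ (3 + 1) * stepScale 3 Lc (lev 1)) * (∏ i ∈ range n, (stepScale 3 Lc (lev (i + 1 + 1)) * ((box (3 + 1) Lc).card : ℝ)))⁻¹)
            * (∏ i ∈ range n, (stepScale 3 Lc (lev (i + 1 + 1)) * ((box (3 + 1) Lc).card : ℝ)))⁻¹) •
            (stepIns₂Sym M Lc ((compRowsSym Lc (fine Lc M) (fun k => lev (k + 1)) (fun k => rs (k + 1)) n) *ᵥ h)
              * compRowsSym Lc (fine Lc M) (fun k => lev (k + 1)) (fun k => rs (k + 1)) n)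
        + ((2 : ℝ) * (((Lc : ℝ) ^ (3 + 1) * stepScale 3 Lc (lev 1)) * (∏ i ∈ range n, (stepScale 3 Lc (lev (i + 1 + 1)) * ((box (3 + 1) Lc).card : ℝ)))⁻¹)) •
            (stepIns₁Sym M Lc ((compRowsSym Lc (fine Lc M) (fun k => lev (k + 1)) (fun k => rs (k + 1)) n) *ᵥ h)
              * compIns₁Sym Lc (fine Lc M) (fun k => lev (k + 1)) (fun k => rs (k + 1)) n h)
        + QstepSym Lc M (lev 1) * compIns₂Sym Lc (fine Lc M) (fun k => lev (k + 1)) (fun k => rs (k + 1)) n h)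
        * (tgrad (towerTorus Lc (fine Lc M) n)).submatrix
            (fun b : ↥(pbox (towerTorus Lc (fine Lc M) n)) × Fin (3 + 1) => ((b.1, Sum.inl b.2) : Idx (towerTorus Lc (fine Lc M) n) (Fib 3))) id
      = (2 : ℝ) • (((((Lc : ℝ) ^ (3 + 1) * stepScale 3 Lc (lev 1)) * (∏ i ∈ range n, (stepScale 3 Lc (lev (i + 1 + 1)) * ((box (3 + 1) Lc).card : ℝ)))⁻¹) •
              (stepIns₁Sym M Lc ((compRowsSym Lc (fine Lc M) (fun k => lev (k + 1)) (fun k => rs (k + 1)) n) *ᵥ h)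
                * compRowsSym Lc (fine Lc M) (fun k => lev (k + 1)) (fun k => rs (k + 1)) n)
            + QstepSym Lc M (lev 1) * compIns₁Sym Lc (fine Lc M) (fun k => lev (k + 1)) (fun k => rs (k + 1)) n h)
            * Matrix.of (fun (b : ↥(pbox (towerTorus Lc (fine Lc M) n)) × Fin (3 + 1)) (s : ↥(pbox (towerTorus Lc (fine Lc M) n))) =>
                h b * tdelta (towerTorus Lc (fine Lc M) n) ((b.1 : Site (3 + 1)) + unitVec b.2) s))
        - QstepSym Lc M (lev 1) * compRowsSym Lc (fine Lc M) (fun k => lev (k + 1)) (fun k => rs (k + 1)) n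
            * Matrix.of (fun (b : ↥(pbox (towerTorus Lc (fine Lc M) n)) × Fin (3 + 1)) (s : ↥(pbox (towerTorus Lc (fine Lc M) n))) =>
                (h b * h b) * tdelta (towerTorus Lc (fine Lc M) n) ((b.1 : Site (3 + 1)) + unitVec b.2) s)
        + (∏ i ∈ range (n + 1), (stepScale 3 Lc (lev (i + 1)) * ((box (3 + 1) Lc).card : ℝ)))⁻¹ •
            Matrix.of (fun (a : ↥(pbox M) × Fin (3 + 1)) (s : ↥(pbox (towerTorus Lc (fine Lc M) n))) =>
              (((QstepSym Lc M (lev 1) * compRowsSym Lc (fine Lc M) (fun k => lev (k + 1)) (fun k => rs (k + 1)) n) *ᵥ h) a) ^ 2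
                * tdelta (towerTorus Lc (fine Lc M) n)
                    ((itRoot Lc (fine Lc M) (fun _ => ctrOff (3 + 1) Lc) (fun _ => hc) n
                        (rootPt M Lc hc (wrapPt M ((a.1 : Site (3 + 1)) + unitVec a.2))) : ↥(pbox (towerTorus Lc (fine Lc M) n))) : Site (3 + 1)) s) := by
  have hB : (box (3 + 1) Lc).Nonempty := ⟨ctrOff (3 + 1) Lc, hc⟩
  have hσ := prod_stepScale_mul_card_ne_zero' Lc hB (fun i => lev (i + 1 + 1)) n
  have hLc : (Lc : ℝ) ^ (3 + 1) ≠ 0 := pow_ne_zero _ (by exact_mod_cast NeZero.ne Lc)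
  have hcθ : (Lc : ℝ) ^ (3 + 1) * stepScale 3 Lc (lev 1) ≠ 0 := mul_ne_zero hLc (stepScale_ne_zero _)
  -- the three scalar identities: `(θ∕σ)·σ = θ`, `θ·c = σ⁻¹`, `θ·c² = σ_{n+1}⁻¹` (`#B = Lc^{d+1}`)
  have k1 : (((Lc : ℝ) ^ (3 + 1) * stepScale 3 Lc (lev 1)) * (∏ i ∈ range n, (stepScale 3 Lc (lev (i + 1 + 1)) * ((box (3 + 1) Lc).card : ℝ)))⁻¹)
        * (∏ i ∈ range n, (stepScale 3 Lc (lev (i + 1 + 1)) * ((box (3 + 1) Lc).card : ℝ)))⁻¹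
        * (∏ i ∈ range n, (stepScale 3 Lc (lev (i + 1 + 1)) * ((box (3 + 1) Lc).card : ℝ)))
      = ((Lc : ℝ) ^ (3 + 1) * stepScale 3 Lc (lev 1)) * (∏ i ∈ range n, (stepScale 3 Lc (lev (i + 1 + 1)) * ((box (3 + 1) Lc).card : ℝ)))⁻¹ := by
    rw [inv_mul_cancel_right₀ hσ]
  have k2 : ((Lc : ℝ) ^ (3 + 1) * stepScale 3 Lc (lev 1)) * (∏ i ∈ range n, (stepScale 3 Lc (lev (i + 1 + 1)) * ((box (3 + 1) Lc).card : ℝ)))⁻¹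
        * ((Lc : ℝ) ^ (3 + 1) * stepScale 3 Lc (lev 1))⁻¹
      = (∏ i ∈ range n, (stepScale 3 Lc (lev (i + 1 + 1)) * ((box (3 + 1) Lc).card : ℝ)))⁻¹ := by
    rw [mul_comm, ← mul_assoc, inv_mul_cancel₀ hcθ, one_mul]
  have k3 : ((Lc : ℝ) ^ (3 + 1) * stepScale 3 Lc (lev 1)) * (∏ i ∈ range n, (stepScale 3 Lc (lev (i + 1 + 1)) * ((box (3 + 1) Lc).card : ℝ)))⁻¹
        * ((Lc : ℝ) ^ (3 + 1) * stepScale 3 Lc (lev 1))⁻¹ ^ 2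
      = (∏ i ∈ range (n + 1), (stepScale 3 Lc (lev (i + 1)) * ((box (3 + 1) Lc).card : ℝ)))⁻¹ := by
    have hst : stepScale 3 Lc (lev 1) ≠ 0 := stepScale_ne_zero _
    have hσ' := hσ
    rw [card_box_cast] at hσ'
    rw [Finset.prod_range_succ', card_box_cast]
    simp only [Nat.zero_add]
    field_simp
  -- the two contact compositions through the lower tower's iterated-root indicator (`of_tdelta_mul`)
  have tipR : ∀ v : ↥(pbox (fine Lc M)) × Fin (3 + 1) → ℝ,
      Matrix.of (fun (b : ↥(pbox (fine Lc M)) × Fin (3 + 1)) (t : ↥(pbox (fine Lc M))) => v b * tdelta (fine Lc M) ((b.1 : Site (3 + 1)) + unitVec b.2) t)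
        * Matrix.of (fun (u : ↥(pbox (fine Lc M))) (s : ↥(pbox (towerTorus Lc (fine Lc M) n))) =>
            tdelta (towerTorus Lc (fine Lc M) n)
              ((itRoot Lc (fine Lc M) (fun _ => ctrOff (3 + 1) Lc) (fun _ => hc) n u : ↥(pbox (towerTorus Lc (fine Lc M) n))) : Site (3 + 1)) s)
      = Matrix.of (fun (a : ↥(pbox (fine Lc M)) × Fin (3 + 1)) (s : ↥(pbox (towerTorus Lc (fine Lc M) n))) =>
          v a * tdelta (towerTorus Lc (fine Lc M) n)
            ((itRoot Lc (fine Lc M) (fun _ => ctrOff (3 + 1) Lc) (fun _ => hc) n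
                (wrapPt (fine Lc M) ((a.1 : Site (3 + 1)) + unitVec a.2)) : ↥(pbox (towerTorus Lc (fine Lc M) n))) : Site (3 + 1)) s) := fun v => by
    rw [of_tdelta_mul (fine Lc M)]
    rfl
  have farR : ∀ v : ↥(pbox M) × Fin (3 + 1) → ℝ,
      Matrix.of (fun (a : ↥(pbox M) × Fin (3 + 1)) (t : ↥(pbox (fine Lc M))) =>
          v a * tdelta (fine Lc M) ((rootPt M Lc hc (wrapPt M ((a.1 : Site (3 + 1)) + unitVec a.2)) : ↥(pbox (fine Lc M))) : Site (3 + 1)) t)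
        * Matrix.of (fun (u : ↥(pbox (fine Lc M))) (s : ↥(pbox (towerTorus Lc (fine Lc M) n))) =>
            tdelta (towerTorus Lc (fine Lc M) n)
              ((itRoot Lc (fine Lc M) (fun _ => ctrOff (3 + 1) Lc) (fun _ => hc) n u : ↥(pbox (towerTorus Lc (fine Lc M) n))) : Site (3 + 1)) s)
      = Matrix.of (fun (a : ↥(pbox M) × Fin (3 + 1)) (s : ↥(pbox (towerTorus Lc (fine Lc M) n))) =>
          v a * tdelta (towerTorus Lc (fine Lc M) n)
            ((itRoot Lc (fine Lc M) (fun _ => ctrOff (3 + 1) Lc) (fun _ => hc) n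
                (rootPt M Lc hc (wrapPt M ((a.1 : Site (3 + 1)) + unitVec a.2))) : ↥(pbox (towerTorus Lc (fine Lc M) n))) : Site (3 + 1)) s) := fun v => by
    rw [of_tdelta_mul (fine Lc M)]
    ext a s
    simp only [Matrix.of_apply, wrapPt_of_mem]
  -- summand 1: the top step's second jet along the transported direction
  have S1 : ((((Lc : ℝ) ^ (3 + 1) * stepScale 3 Lc (lev 1)) * (∏ i ∈ range n, (stepScale 3 Lc (lev (i + 1 + 1)) * ((box (3 + 1) Lc).card : ℝ)))⁻¹)
            * (∏ i ∈ range n, (stepScale 3 Lc (lev (i + 1 + 1)) * ((box (3 + 1) Lc).card : ℝ)))⁻¹) •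
            (stepIns₂Sym M Lc ((compRowsSym Lc (fine Lc M) (fun k => lev (k + 1)) (fun k => rs (k + 1)) n) *ᵥ h)
              * compRowsSym Lc (fine Lc M) (fun k => lev (k + 1)) (fun k => rs (k + 1)) n)
        * (tgrad (towerTorus Lc (fine Lc M) n)).submatrix
            (fun b : ↥(pbox (towerTorus Lc (fine Lc M) n)) × Fin (3 + 1) => ((b.1, Sum.inl b.2) : Idx (towerTorus Lc (fine Lc M) n) (Fib 3))) id
      = ((2 : ℝ) * (((Lc : ℝ) ^ (3 + 1) * stepScale 3 Lc (lev 1)) * (∏ i ∈ range n, (stepScale 3 Lc (lev (i + 1 + 1)) * ((box (3 + 1) Lc).card : ℝ)))⁻¹)) •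
            (stepIns₁Sym M Lc ((compRowsSym Lc (fine Lc M) (fun k => lev (k + 1)) (fun k => rs (k + 1)) n) *ᵥ h)
              * Matrix.of (fun (a : ↥(pbox (fine Lc M)) × Fin (3 + 1)) (s : ↥(pbox (towerTorus Lc (fine Lc M) n))) =>
                  (compRowsSym Lc (fine Lc M) (fun k => lev (k + 1)) (fun k => rs (k + 1)) n *ᵥ h) a
                    * tdelta (towerTorus Lc (fine Lc M) n)
                        ((itRoot Lc (fine Lc M) (fun _ => ctrOff (3 + 1) Lc) (fun _ => hc) n
                            (wrapPt (fine Lc M) ((a.1 : Site (3 + 1)) + unitVec a.2)) : ↥(pbox (towerTorus Lc (fine Lc M) n))) : Site (3 + 1)) s))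
        - (∏ i ∈ range n, (stepScale 3 Lc (lev (i + 1 + 1)) * ((box (3 + 1) Lc).card : ℝ)))⁻¹ •
            (QstepSym Lc M (lev 1)
              * Matrix.of (fun (a : ↥(pbox (fine Lc M)) × Fin (3 + 1)) (s : ↥(pbox (towerTorus Lc (fine Lc M) n))) =>
                  ((compRowsSym Lc (fine Lc M) (fun k => lev (k + 1)) (fun k => rs (k + 1)) n *ᵥ h) a * (compRowsSym Lc (fine Lc M) (fun k => lev (k + 1)) (fun k => rs (k + 1)) n *ᵥ h) a)
                    * tdelta (towerTorus Lc (fine Lc M) n)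
                        ((itRoot Lc (fine Lc M) (fun _ => ctrOff (3 + 1) Lc) (fun _ => hc) n
                            (wrapPt (fine Lc M) ((a.1 : Site (3 + 1)) + unitVec a.2)) : ↥(pbox (towerTorus Lc (fine Lc M) n))) : Site (3 + 1)) s))
        + (∏ i ∈ range (n + 1), (stepScale 3 Lc (lev (i + 1)) * ((box (3 + 1) Lc).card : ℝ)))⁻¹ •
            Matrix.of (fun (a : ↥(pbox M) × Fin (3 + 1)) (s : ↥(pbox (towerTorus Lc (fine Lc M) n))) =>
              (((QstepSym Lc M (lev 1) * compRowsSym Lc (fine Lc M) (fun k => lev (k + 1)) (fun k => rs (k + 1)) n) *ᵥ h) a) ^ 2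
                * tdelta (towerTorus Lc (fine Lc M) n)
                    ((itRoot Lc (fine Lc M) (fun _ => ctrOff (3 + 1) Lc) (fun _ => hc) n
                        (rootPt M Lc hc (wrapPt M ((a.1 : Site (3 + 1)) + unitVec a.2))) : ↥(pbox (towerTorus Lc (fine Lc M) n))) : Site (3 + 1)) s) := by
    rw [Matrix.smul_mul, Matrix.mul_assoc, compRowsSym_mul_tgrad Lc hc n (fine Lc M) _ _, Matrix.mul_smul, ← Matrix.mul_assoc,
      stepIns₂Sym_mul_tgrad M Lc hc (lev 1), smul_smul, k1, Matrix.add_mul, Matrix.sub_mul, Matrix.smul_mul, Matrix.smul_mul, Matrix.smul_mul,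
      Matrix.mul_assoc, Matrix.mul_assoc, tipR, tipR, farR, smul_add, smul_sub, smul_smul, smul_smul, smul_smul, k2, k3, Matrix.mulVec_mulVec,
      mul_comm (((Lc : ℝ) ^ (3 + 1) * stepScale 3 Lc (lev 1)) * (∏ i ∈ range n, (stepScale 3 Lc (lev (i + 1 + 1)) * ((box (3 + 1) Lc).card : ℝ)))⁻¹) (2 : ℝ)]
  -- summand 2: twice the top step's first jet on the lower composite's first jet (C1's lower law)
  have S2 : ((2 : ℝ) * (((Lc : ℝ) ^ (3 + 1) * stepScale 3 Lc (lev 1)) * (∏ i ∈ range n, (stepScale 3 Lc (lev (i + 1 + 1)) * ((box (3 + 1) Lc).card : ℝ)))⁻¹)) •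
            (stepIns₁Sym M Lc ((compRowsSym Lc (fine Lc M) (fun k => lev (k + 1)) (fun k => rs (k + 1)) n) *ᵥ h)
              * compIns₁Sym Lc (fine Lc M) (fun k => lev (k + 1)) (fun k => rs (k + 1)) n h)
        * (tgrad (towerTorus Lc (fine Lc M) n)).submatrix
            (fun b : ↥(pbox (towerTorus Lc (fine Lc M) n)) × Fin (3 + 1) => ((b.1, Sum.inl b.2) : Idx (towerTorus Lc (fine Lc M) n) (Fib 3))) id
      = ((2 : ℝ) * (((Lc : ℝ) ^ (3 + 1) * stepScale 3 Lc (lev 1)) * (∏ i ∈ range n, (stepScale 3 Lc (lev (i + 1 + 1)) * ((box (3 + 1) Lc).card : ℝ)))⁻¹)) •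
            (stepIns₁Sym M Lc ((compRowsSym Lc (fine Lc M) (fun k => lev (k + 1)) (fun k => rs (k + 1)) n) *ᵥ h)
              * (compRowsSym Lc (fine Lc M) (fun k => lev (k + 1)) (fun k => rs (k + 1)) n
                * Matrix.of (fun (b : ↥(pbox (towerTorus Lc (fine Lc M) n)) × Fin (3 + 1)) (s : ↥(pbox (towerTorus Lc (fine Lc M) n))) =>
                    h b * tdelta (towerTorus Lc (fine Lc M) n) ((b.1 : Site (3 + 1)) + unitVec b.2) s)))
        - ((2 : ℝ) * (((Lc : ℝ) ^ (3 + 1) * stepScale 3 Lc (lev 1)) * (∏ i ∈ range n, (stepScale 3 Lc (lev (i + 1 + 1)) * ((box (3 + 1) Lc).card : ℝ)))⁻¹)) •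
            (stepIns₁Sym M Lc ((compRowsSym Lc (fine Lc M) (fun k => lev (k + 1)) (fun k => rs (k + 1)) n) *ᵥ h)
              * Matrix.of (fun (a : ↥(pbox (fine Lc M)) × Fin (3 + 1)) (s : ↥(pbox (towerTorus Lc (fine Lc M) n))) =>
                  (compRowsSym Lc (fine Lc M) (fun k => lev (k + 1)) (fun k => rs (k + 1)) n *ᵥ h) a
                    * tdelta (towerTorus Lc (fine Lc M) n)
                        ((itRoot Lc (fine Lc M) (fun _ => ctrOff (3 + 1) Lc) (fun _ => hc) n
                            (wrapPt (fine Lc M) ((a.1 : Site (3 + 1)) + unitVec a.2)) : ↥(pbox (towerTorus Lc (fine Lc M) n))) : Site (3 + 1)) s)) := by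
    rw [Matrix.smul_mul, Matrix.mul_assoc, compIns₁Sym_mul_tgrad Lc hc n (fine Lc M) _ _ h, Matrix.mul_sub, smul_sub]
  rw [Matrix.add_mul, Matrix.add_mul, S1, S2, Matrix.mul_assoc, ih, Matrix.mul_add, Matrix.mul_sub, Matrix.mul_smul, Matrix.mul_smul, Matrix.add_mul,
    Matrix.smul_mul, smul_add, smul_smul, Matrix.mul_assoc, Matrix.mul_assoc, Matrix.mul_assoc]
  have e2 : Matrix.of (fun (a : ↥(pbox (fine Lc M)) × Fin (3 + 1)) (s : ↥(pbox (towerTorus Lc (fine Lc M) n))) =>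
        ((compRowsSym Lc (fine Lc M) (fun k => lev (k + 1)) (fun k => rs (k + 1)) n *ᵥ h) a * (compRowsSym Lc (fine Lc M) (fun k => lev (k + 1)) (fun k => rs (k + 1)) n *ᵥ h) a)
          * tdelta (towerTorus Lc (fine Lc M) n)
              ((itRoot Lc (fine Lc M) (fun _ => ctrOff (3 + 1) Lc) (fun _ => hc) n
                  (wrapPt (fine Lc M) ((a.1 : Site (3 + 1)) + unitVec a.2)) : ↥(pbox (towerTorus Lc (fine Lc M) n))) : Site (3 + 1)) s)
      = Matrix.of (fun (a : ↥(pbox (fine Lc M)) × Fin (3 + 1)) (s : ↥(pbox (towerTorus Lc (fine Lc M) n))) =>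
        ((compRowsSym Lc (fine Lc M) (fun k => lev (k + 1)) (fun k => rs (k + 1)) n *ᵥ h) a) ^ 2
          * tdelta (towerTorus Lc (fine Lc M) n)
              ((itRoot Lc (fine Lc M) (fun _ => ctrOff (3 + 1) Lc) (fun _ => hc) n
                  (wrapPt (fine Lc M) ((a.1 : Site (3 + 1)) + unitVec a.2)) : ↥(pbox (towerTorus Lc (fine Lc M) n))) : Site (3 + 1)) s) := by
    ext a s; rw [Matrix.of_apply, Matrix.of_apply, sq]
  rw [e2]
  abel

/-- [folklore] **`compIns₂Sym_mul_tgrad` — (COV-m) ORDER 2: THE COMPOSITE SECOND-ORDER INSERTION JET's GAUGE-COVARIANCE LAW ON ALL COLUMNS, AT EVERY DEPTH**: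
`compIns₂ … n h · D_finest = 2 • (compIns₁ … n h · Tip(h)) − compRows … n · Tip(h⊙h) + σ_n⁻¹ • Far_n((compRows … n · h)⊙(compRows … n · h))` — `Tip(v)(b, s) = v b · [s ≡
b.1 + e_{b.2}]` (tip contact on the finest torus), `Far_n(v)(a, s) = v a · [s = itRoot n (a.1 + e_{a.2})]` (contact at the ITERATED ROOT of the far endpoint of the top
bond `a`), `σ_n = ∏_{i<n} stepScale 3 Lc (lev (i+1))·#B`.  Depth `0`: `0 = 0 − Tip(h⊙h) + Tip(h⊙h)`; the step is `compIns₂Sym_mul_tgrad_step`.  PART 3 reads this through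
the tower generators (`towerGen = D_finest · evalN`): the tip terms are `−2•Q₁₁·W₁ − Q₁₀·W₂`, the far-root term on the top block is the coarse jet `D̄₂ = σ⁻¹c²(Q₁₀h)²[tip]`,
on the lower blocks it VANISHES — the door's `c2` with the PURE SQUARE. -/
theorem compIns₂Sym_mul_tgrad (hc : ctrOff (3 + 1) Lc ∈ box (3 + 1) Lc) :
    ∀ (n : ℕ) (M : Fin (3 + 1) → ℕ) [∀ μ, NeZero (M μ)] (lev : ℕ → ℕ) (rs : ℕ → (Fin (3 + 1) → ℕ))
      (h : ↥(pbox (towerTorus Lc M n)) × Fin (3 + 1) → ℝ),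
      compIns₂Sym Lc M lev rs n h
          * (tgrad (towerTorus Lc M n)).submatrix
              (fun b : ↥(pbox (towerTorus Lc M n)) × Fin (3 + 1) => ((b.1, Sum.inl b.2) : Idx (towerTorus Lc M n) (Fib 3))) id
        = (2 : ℝ) • (compIns₁Sym Lc M lev rs n h
              * Matrix.of (fun (b : ↥(pbox (towerTorus Lc M n)) × Fin (3 + 1)) (s : ↥(pbox (towerTorus Lc M n))) =>
                  h b * tdelta (towerTorus Lc M n) ((b.1 : Site (3 + 1)) + unitVec b.2) s))
          - compRowsSym Lc M lev rs n
              * Matrix.of (fun (b : ↥(pbox (towerTorus Lc M n)) × Fin (3 + 1)) (s : ↥(pbox (towerTorus Lc M n))) =>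
                  (h b * h b) * tdelta (towerTorus Lc M n) ((b.1 : Site (3 + 1)) + unitVec b.2) s)
          + (∏ i ∈ range n, (stepScale 3 Lc (lev (i + 1)) * ((box (3 + 1) Lc).card : ℝ)))⁻¹ •
              Matrix.of (fun (a : ↥(pbox M) × Fin (3 + 1)) (s : ↥(pbox (towerTorus Lc M n))) =>
                ((compRowsSym Lc M lev rs n *ᵥ h) a) ^ 2
                  * tdelta (towerTorus Lc M n) ((itRoot Lc M (fun _ => ctrOff (3 + 1) Lc) (fun _ => hc) n (wrapPt M ((a.1 : Site (3 + 1)) + unitVec a.2)) : ↥(pbox (towerTorus Lc M n))) : Site (3 + 1)) s)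
  | 0, M, _, lev, rs, h => by
    show (0 : Matrix (↥(pbox M) × Fin (3 + 1)) (↥(pbox M) × Fin (3 + 1)) ℝ)
          * (tgrad M).submatrix (fun b : ↥(pbox M) × Fin (3 + 1) => ((b.1, Sum.inl b.2) : Idx M (Fib 3))) id
        = (2 : ℝ) • ((0 : Matrix (↥(pbox M) × Fin (3 + 1)) (↥(pbox M) × Fin (3 + 1)) ℝ)
              * Matrix.of (fun (b : ↥(pbox M) × Fin (3 + 1)) (s : ↥(pbox M)) => h b * tdelta M ((b.1 : Site (3 + 1)) + unitVec b.2) s))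
          - (1 : Matrix (↥(pbox M) × Fin (3 + 1)) (↥(pbox M) × Fin (3 + 1)) ℝ)
              * Matrix.of (fun (b : ↥(pbox M) × Fin (3 + 1)) (s : ↥(pbox M)) => (h b * h b) * tdelta M ((b.1 : Site (3 + 1)) + unitVec b.2) s)
          + (∏ i ∈ range 0, (stepScale 3 Lc (lev (i + 1)) * ((box (3 + 1) Lc).card : ℝ)))⁻¹ •
              Matrix.of (fun (a : ↥(pbox M) × Fin (3 + 1)) (s : ↥(pbox M)) =>
                (((1 : Matrix (↥(pbox M) × Fin (3 + 1)) (↥(pbox M) × Fin (3 + 1)) ℝ) *ᵥ h) a) ^ 2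
                  * tdelta M ((wrapPt M ((a.1 : Site (3 + 1)) + unitVec a.2) : ↥(pbox M)) : Site (3 + 1)) s)
    rw [Matrix.zero_mul, Matrix.zero_mul, smul_zero, Matrix.one_mul, Matrix.one_mulVec, prod_range_zero, inv_one, one_smul, zero_sub, eq_comm,
      neg_add_eq_zero]
    ext a s
    rw [Matrix.of_apply, Matrix.of_apply, tdelta_wrapPt, sq]
  | n + 1, M, _, lev, rs, h => by
    rw [compIns₂Sym_succ]
    exact compIns₂Sym_mul_tgrad_step Lc n M lev rs hc h (compIns₂Sym_mul_tgrad hc n (fine Lc M) (fun k => lev (k + 1)) (fun k => rs (k + 1)) h)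

end Tower

end Summit.QuantumFields.BalabanUV.Beta.FP.TorusCompositeCovarianceTwoSym

end
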